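import Literature.NumberTheory.DiophantineGeometry.FunctionFieldDedekindKummer
import Literature.FieldTheory.ArtinSchreier.PrimeDegree
import Literature.FieldTheory.ArtinSchreier.CyclicDegreeP
import Mathlib.FieldTheory.Finite.Trace
import HarnessLib

/-!
# Decomposition of places in Artin–Schreier extensions `y^p - y = w` of a function field over a
finite field: the trace criterion, and total ramification at poles of order prime to `p`
(Stichtenoth Prop. 3.7.8; Lidl–Niederreiter Thm. 2.25)

Topic: `Literature/NumberTheory/DiophantineGeometry` (places `AlgFunctionField.PlaceOver`). Let `K` be
a finite field of characteristic `p`, `F'/F` a separable extension of algebraic function fields over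
`K` of degree `p` generated by `y` with `y^p - y = w ∈ F`, and `P` a place of `F`.

* **Unramified places, `w ∈ 𝒪_P`** (Stichtenoth Prop. 3.7.8 (b): `m_P = -1`). Let `w̄ ∈ F_P` be
  the residue of `w`. By Kummer's theorem (the tree's `PlaceOver.exists_placesOver_of_prod_eq`,
  Stichtenoth Thm. 3.3.7) the places above `P` correspond to the monic irreducible factors of
  `T^p - T - w̄ ∈ F_P[T]`, and by Lang's dichotomy for Artin–Schreier polynomials (the tree's
  `X_pow_sub_X_sub_C_eq_prod` / `X_pow_sub_X_sub_C_irreducible`) this polynomial either has a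
  root `z̄ ∈ F_P` and then splits into the `p` distinct linear factors `T - (z̄ + i)`, or is
  irreducible. Hence
  - `PlaceOver.exists_placesOver_artinSchreier_split`: if `w̄ ∈ ℘(F_P)` there are exactly `p`
    places above `P`, all of degree `deg P` (and unramified) — **`P` splits completely**;
  - `PlaceOver.exists_placeOver_artinSchreier_inert`: if `w̄ ∉ ℘(F_P)` there is exactly one place
    above `P`, of degree `p · deg P` (and unramified) — **`P` is inert**;
  - `PlaceOver.sum_degree_placesOver_artinSchreier`: consequently, for every `s`,
    `Σ_{P'|P, deg P' ∣ s} deg P' = p · deg P · [deg P ∣ s]` in the split case and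
    `= p · deg P · [p deg P ∣ s]` in the inert case (the contribution of `P` to the number `N_s` of
    places of `F'` of degree dividing `s`).
* **The trace criterion** `FiniteField.exists_pow_sub_self_eq_iff_trace_eq_zero` (Hilbert's
  Theorem 90, additive form, for `𝔽_p ⊆ L` finite; Lidl–Niederreiter Thm. 2.25): `c = z^p - z` for
  some `z ∈ L` iff `Tr_{L/𝔽_p}(c) = 0`. So `P` splits completely iff `Tr_{F_P/𝔽_p}(w̄) = 0`
  (`PlaceOver.artinSchreier_split_iff_trace_eq_zero`); this is the decomposition law
  `Frob_P = Tr_{F_P/𝔽_p}(w̄) ∈ 𝔽_p = Gal(F'/F)` of the Artin–Schreier covering, in counting form.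
* **Total ramification at a pole of order prime to `p`** (Stichtenoth Prop. 3.7.8 (c) with
  `m_P = m`, generalising the tree's `totallyRamified_of_pow_sub_eq`, which is the case `m = 1`):
  `PlaceOver.totallyRamified_of_pow_sub_eq_of_coprime` — if `v_P(w) = -m < 0` with
  `gcd(m, n) = 1`, `y^n - y = w` and `[F' : F] ≤ n`, then `e(P'|P) = n = [F' : F]`, `P'` is the only
  place above `P`, `deg P' = deg P` and `v_{P'}(y) = -m` (no hypothesis on the characteristic).

These are the local ingredients of the point counts `N_s` of the coverings `z^p - z = α f` of an
elliptic function field used for the Kohel–Shparlinski bound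
(`Literature.NumberTheory.EllipticCurves.KohelShparlinski.CoordinateCharSumBound`: `f = x` has
double poles, `p` odd; `f = y` triple poles, `p ≠ 3`). Everything is proved; no definitions; no
named facts.

## References

* H. Stichtenoth, *Algebraic Function Fields and Codes*, 2nd ed., GTM 254, Springer 2009:
  Thm. 3.3.7 (Kummer), Prop. 3.7.8 (Artin–Schreier extensions; held copy p. 113).
  [Stichtenoth2009]
* R. Lidl, H. Niederreiter, *Finite Fields*, 2nd ed., Cambridge UP 1997, Thm. 2.25 (Hilbert's
  Theorem 90, additive form for finite fields). [LidlNiederreiter1996]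
* S. Lang, *Algebra*, GTM 211, Ch. VI §6 Thm. 6.4 (Artin–Schreier polynomials). [Lang2002]
-/

noncomputable section

open scoped Classical IntermediateField
open Polynomial

/-! ### Hilbert 90, additive form, for finite fields -/

namespace Literature.FieldTheory.ArtinSchreier

/-- The elements `s` of a field of characteristic `p` with `s^p = s` number at most `p` (they are the
natural numbers `< p`). [folklore] -/
theorem natCard_setOf_pow_eq_self_le {E : Type*} [Field E] (p : ℕ) [Fact p.Prime] [CharP E p] :
    Nat.card {s : E // s ^ p = s} ≤ p := by
  have hfin : Set.Finite {s : E | s ^ p = s} := by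
    refine (Set.finite_range (fun i : Fin p => ((i : ℕ) : E))).subset ?_
    intro s hs
    obtain ⟨i, hi, rfl⟩ := exists_natCast_eq_of_pow_eq_self p hs
    exact ⟨⟨i, hi⟩, rfl⟩
  haveI : Fintype {s : E // s ^ p = s} := hfin.fintype
  rw [Nat.card_eq_fintype_card]
  have h : Fintype.card {s : E // s ^ p = s} ≤ Fintype.card (Fin p) := by
    refine Fintype.card_le_of_surjective (fun i : Fin p => (⟨((i : ℕ) : E), ?_⟩ : {s : E // s ^ p = s})) ?_
    · have h := map_natCast (frobenius E p) (i : ℕ)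
      rwa [frobenius_def] at h
    · rintro ⟨s, hs⟩
      obtain ⟨i, hi, his⟩ := exists_natCast_eq_of_pow_eq_self p hs
      exact ⟨⟨i, hi⟩, Subtype.ext his⟩
  simpa using h

/-- **Hilbert's Theorem 90, additive form, for finite fields** (Lidl–Niederreiter Thm. 2.25): for a
finite field `L ⊇ 𝔽_p` and `c ∈ L`, the equation `z^p - z = c` has a solution `z ∈ L` if and only
if `Tr_{L/𝔽_p}(c) = 0`. Proof: "⇒" as `Tr(z^p) = Tr(Frob z) = Tr(z)`; "⇐" by counting: the
`𝔽_p`-linear map `℘(z) = z^p - z` has kernel `𝔽_p`, so its image has codimension `1` and is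
contained in, hence equal to, the kernel of the (surjective) trace.
[cite: LidlNiederreiter1996, Thm. 2.25] -/
theorem FiniteField.exists_pow_sub_self_eq_iff_trace_eq_zero {L : Type*} [Field L] [Finite L]
    (p : ℕ) [Fact p.Prime] [CharP L p] [Algebra (ZMod p) L] (c : L) :
    (∃ z : L, z ^ p - z = c) ↔ Algebra.trace (ZMod p) L c = 0 := by
  have hp : p.Prime := Fact.out
  haveI : Fintype L := Fintype.ofFinite L
  haveI : FiniteDimensional (ZMod p) L := Module.Finite.of_finite
  haveI : Algebra.IsAlgebraic (ZMod p) L := Algebra.IsAlgebraic.of_finite (ZMod p) L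
  -- the Frobenius as an `𝔽_p`-automorphism, and `Tr ∘ Frob = Tr`
  set φ := FiniteField.frobeniusAlgEquivOfAlgebraic (ZMod p) L with hφ
  have hφapp : ∀ z : L, φ z = z ^ p := fun z => by
    have h := congrFun (FiniteField.coe_frobeniusAlgEquivOfAlgebraic (ZMod p) L) z
    rw [ZMod.card] at h
    exact h
  have htrpow : ∀ z : L, Algebra.trace (ZMod p) L (z ^ p) = Algebra.trace (ZMod p) L z := fun z => by
    rw [← hφapp, Algebra.trace_eq_of_algEquiv]
  constructor
  · rintro ⟨z, rfl⟩
    rw [map_sub, htrpow, sub_self]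
  · intro hc
    -- `℘` as a linear map
    set ℘ : L →ₗ[ZMod p] L :=
      { toFun := fun z => z ^ p - z
        map_add' := fun a b => by
          simp only [add_pow_char]
          ring
        map_smul' := fun a z => by
          simp only [RingHom.id_apply, Algebra.smul_def, mul_pow]
          rw [← map_pow, ZMod.pow_card]
          ring } with h℘
    have h℘app : ∀ z : L, ℘ z = z ^ p - z := fun z => rfl
    -- its kernel has dimension `≤ 1`
    have hker : Module.finrank (ZMod p) (LinearMap.ker ℘) ≤ 1 := by
      have hcard : Nat.card (LinearMap.ker ℘) ≤ p := by
        have e : (LinearMap.ker ℘) ≃ {s : L // s ^ p = s} :=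
          { toFun := fun z => ⟨z.1, sub_eq_zero.mp (LinearMap.mem_ker.mp z.2)⟩
            invFun := fun s => ⟨s.1, by rw [LinearMap.mem_ker, h℘app, s.2, sub_self]⟩
            left_inv := fun z => rfl
            right_inv := fun s => rfl }
        rw [Nat.card_congr e]
        exact natCard_setOf_pow_eq_self_le p
      have hpow := Module.natCard_eq_pow_finrank (K := ZMod p) (V := LinearMap.ker ℘)
      rw [Nat.card_zmod] at hpow
      rw [hpow] at hcard
      exact (Nat.pow_le_pow_iff_right hp.one_lt).mp (by simpa using hcard)
    -- the trace is onto `𝔽_p`, so its kernel has codimension `1`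
    have hT : Module.finrank (ZMod p) (LinearMap.ker (Algebra.trace (ZMod p) L)) + 1 =
        Module.finrank (ZMod p) L := by
      have h1 := LinearMap.finrank_range_add_finrank_ker (Algebra.trace (ZMod p) L)
      have hr : Module.finrank (ZMod p) (LinearMap.range (Algebra.trace (ZMod p) L)) = 1 := by
        rw [LinearMap.range_eq_top.mpr (Algebra.trace_surjective (ZMod p) L), finrank_top,
          Module.finrank_self]
      omega
    have h℘rk := LinearMap.finrank_range_add_finrank_ker ℘
    -- `range ℘ ⊆ ker Tr`, with `finrank (ker Tr) ≤ finrank (range ℘)`: equality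
    have hle : LinearMap.range ℘ ≤ LinearMap.ker (Algebra.trace (ZMod p) L) := by
      rintro _ ⟨z, rfl⟩
      rw [LinearMap.mem_ker, h℘app, map_sub, htrpow, sub_self]
    have heq : LinearMap.range ℘ = LinearMap.ker (Algebra.trace (ZMod p) L) :=
      Submodule.eq_of_le_of_finrank_le hle (by omega)
    have hmem : c ∈ LinearMap.range ℘ := by
      rw [heq, LinearMap.mem_ker]
      exact hc
    obtain ⟨z, hz⟩ := hmem
    exact ⟨z, hz⟩

end Literature.FieldTheory.ArtinSchreier

/-! ### Places of a function field in an Artin–Schreier extension -/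

namespace Literature.NumberTheory.DiophantineGeometry.AlgFunctionField

namespace PlaceOver

open Literature.FieldTheory.ArtinSchreier

universe u v

variable {K : Type u} {F : Type v} {F' : Type v} [Field K] [Field F] [Algebra K F]
variable [Field F'] [Algebra F F'] [Algebra K F'] [IsScalarTower K F F']
variable [IsAlgFunctionField K F] [FiniteDimensional F F'] [IsAlgFunctionField K F']

/-! #### Total ramification above a pole of order prime to the exponent -/

omit [IsAlgFunctionField K F'] in
/-- **Valuations in `yⁿ - y = w` above a pole of `w`.** If `v_P(w) = -m < 0`, `yⁿ - y = w` in
`F' ⊇ F` (`n ≥ 2`) and `P'` lies above `P`, then `v_{P'}(y) < 0` and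
`n · (-v_{P'}(y)) = e(P'|P) · m`. [cite: Stichtenoth2009, Prop. 3.7.8 (proof)] -/
theorem ord_mul_eq_of_pow_sub_eq_of_ord_eq_neg {P : PlaceOver K F} {P' : PlaceOver K F'}
    (h : P'.restrict (K := K) (F := F) = P) {y : F'} {w : F} {n m : ℕ} (hn : 2 ≤ n) (hm : 0 < m)
    (hy : y ^ n - y = algebraMap F F' w) (hw : P.ord w = -m) :
    P'.ord y < 0 ∧
      (n : ℤ) * (-P'.ord y) = P'.ord (algebraMap F F' (P.uniformizer : F)) * m := by
  have hw0 : w ≠ 0 := P.ne_zero_of_ord_ne_zero (by rw [hw]; omega)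
  have he := P'.one_le_ord_algebraMap_uniformizer (K := K) (F := F)
  rw [h] at he
  have hordw : P'.ord (algebraMap F F' w) = -(P'.ord (algebraMap F F' (P.uniformizer : F)) * m) := by
    have := P'.ord_algebraMap_eq_mul (K := K) w
    rw [h, hw] at this; rw [this]; ring
  have hw'0 : algebraMap F F' w ≠ 0 := (_root_.map_ne_zero _).2 hw0
  have hy0 : y ≠ 0 := by
    rintro rfl
    rw [zero_pow (by omega), sub_zero] at hy
    exact hw'0 hy.symm
  -- `v_{P'}(y) < 0`
  have hyneg : P'.ord y < 0 := by
    by_contra hnn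
    push Not at hnn
    have hyO : y ∈ P'.toValuationSubring := (P'.mem_toValuationSubring_iff_ord_nonneg hy0).2 hnn
    have hmem : y ^ n - y ∈ P'.toValuationSubring := sub_mem (pow_mem hyO n) hyO
    rw [hy, P'.mem_toValuationSubring_iff_ord_nonneg hw'0, hordw] at hmem
    have : (1 : ℤ) * 1 ≤ P'.ord (algebraMap F F' (P.uniformizer : F)) * m :=
      mul_le_mul he (by exact_mod_cast hm) zero_le_one (by omega)
    omega
  refine ⟨hyneg, ?_⟩
  -- strict triangle inequality: `v(yⁿ - y) = n v(y)`
  have hpow : P'.ord (y ^ n) = n * P'.ord y := P'.ord_pow hy0 n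
  have hlt : P'.ord (y ^ n) < P'.ord (-y) := by
    rw [hpow, P'.ord_neg]
    have : (n : ℤ) * P'.ord y ≤ 2 * P'.ord y := by nlinarith
    omega
  have hst := P'.ord_add_eq_left_of_lt (pow_ne_zero n hy0) (neg_ne_zero.2 hy0) hlt
  rw [← sub_eq_add_neg, hy, hordw, hpow] at hst
  linarith [hst.2]

/-- **Total ramification above a pole of order prime to `n`** (Stichtenoth Prop. 3.7.8 (c) with
`m_P = m`; the tree's `totallyRamified_of_pow_sub_eq` is the case `m = 1`): if `v_P(w) = -m < 0`
with `gcd(m, n) = 1`, `yⁿ - y = w` and `[F' : F] ≤ n` (`n ≥ 2`), then `v_{P'}(y) = -m`,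
`e(P'|P) = n = [F' : F]`, `P'` is the only place of `F'` above `P`, and `deg P' = deg P`. Proof:
`n · (-v_{P'}(y)) = e · m` with `e ≤ [F' : F] ≤ n` forces `n ∣ e`, so `e = n`.
[cite: Stichtenoth2009, Prop. 3.7.8] -/
theorem totallyRamified_of_pow_sub_eq_of_coprime {P : PlaceOver K F} {P' : PlaceOver K F'}
    (h : P'.restrict (K := K) (F := F) = P) {y : F'} {w : F} {n m : ℕ} (hn : 2 ≤ n) (hm : 0 < m)
    (hcop : Nat.Coprime m n) (hdeg : Module.finrank F F' ≤ n) (hy : y ^ n - y = algebraMap F F' w)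
    (hw : P.ord w = -m) :
    P'.ord y = -m ∧ P'.ord (algebraMap F F' (P.uniformizer : F)) = n ∧ Module.finrank F F' = n ∧
      (∀ P'' : PlaceOver K F', P''.restrict (K := K) (F := F) = P → P'' = P') ∧
      P'.degree = P.degree := by
  obtain ⟨hyneg, hmul⟩ := ord_mul_eq_of_pow_sub_eq_of_ord_eq_neg h hn hm hy hw
  have hle := ord_algebraMap_uniformizer_le_finrank h
  set e := P'.ord (algebraMap F F' (P.uniformizer : F)) with he
  have he1 : 1 ≤ e := by
    have := P'.one_le_ord_algebraMap_uniformizer (K := K) (F := F)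
    rwa [h] at this
  -- `e` as a natural number
  obtain ⟨e', hee'⟩ : ∃ e' : ℕ, (e' : ℤ) = e := ⟨e.toNat, Int.toNat_of_nonneg (by omega)⟩
  obtain ⟨a, ha⟩ : ∃ a : ℕ, (a : ℤ) = -P'.ord y := ⟨(-P'.ord y).toNat, Int.toNat_of_nonneg (by omega)⟩
  have hmul' : n * a = e' * m := by
    have : (n : ℤ) * a = e' * m := by rw [ha, hee']; exact hmul
    exact_mod_cast this
  -- `n ∣ e' m` and `gcd(n, m) = 1`, so `n ∣ e'`
  have hdvd : n ∣ e' := by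
    have h1 : n ∣ e' * m := ⟨a, by rw [← hmul', mul_comm]⟩
    exact (Nat.Coprime.dvd_of_dvd_mul_right hcop.symm h1)
  have he'le : e' ≤ n := by
    have : (e' : ℤ) ≤ n := by rw [hee']; exact hle.trans (by exact_mod_cast hdeg)
    exact_mod_cast this
  have he'pos : 0 < e' := by
    have : (0 : ℤ) < e' := by rw [hee']; omega
    exact_mod_cast this
  have he'n : e' = n := le_antisymm he'le (Nat.le_of_dvd he'pos hdvd)
  have hen : e = n := by rw [← hee', he'n]
  have hfin : Module.finrank F F' = n := by
    apply le_antisymm hdeg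
    have : (n : ℤ) ≤ Module.finrank F F' := hen ▸ hle
    exact_mod_cast this
  have ham : a = m := by
    rw [he'n] at hmul'
    exact Nat.eq_of_mul_eq_mul_left (by omega) hmul'
  have hym : P'.ord y = -m := by
    have : (a : ℤ) = m := by exact_mod_cast ham
    omega
  have htot := eq_of_ord_algebraMap_uniformizer_eq_finrank h (by rw [← he, hen, hfin])
  exact ⟨hym, hen, hfin, htot.1, htot.2⟩

/-! #### Unramified places: the residue polynomial `T^p - T - w̄` -/

variable [Algebra.IsSeparable F F'] [Finite K]
variable (p : ℕ) [CharP K p]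

omit [IsScalarTower K F F'] [IsAlgFunctionField K F] [FiniteDimensional F F']
  [Algebra.IsSeparable F F'] [Finite K] [IsAlgFunctionField K F'] [Algebra F F'] [Field F'] in
/-- The residue field of a place has characteristic `p`. [folklore] -/
theorem charP_residueField (P : PlaceOver K F) : CharP P.residueField p :=
  charP_of_injective_algebraMap (algebraMap K P.residueField).injective p

variable [Fact p.Prime]

/-- **Complete splitting in an Artin–Schreier extension** (Stichtenoth Prop. 3.7.8 (b) with Kummer's
theorem 3.3.7 / Cor. 3.3.8 (b)): let `y^p - y = w` generate `F'/F` of degree `p`, `w ∈ 𝒪_P`, and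
suppose the residue `w̄ ∈ F_P` is of the form `z̄^p - z̄`. Then there are exactly `p` places of `F'`
above `P`; each has degree `deg P` and is unramified. (The residue polynomial is
`T^p - T - w̄ = ∏_{i ∈ 𝔽_p} (T - (z̄ + i))`, `p` distinct linear factors.)
[cite: Stichtenoth2009, Prop. 3.7.8 and Thm. 3.3.7] -/
theorem exists_placesOver_artinSchreier_split (P : PlaceOver K F) {y : F'} {w : F}
    (hw : w ∈ P.toValuationSubring) (hy : y ^ p - y = algebraMap F F' w) (htop : F⟮y⟯ = ⊤)
    (hdeg : Module.finrank F F' = p)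
    (hz : ∃ z : P.residueField, z ^ p - z = IsLocalRing.residue P.toValuationSubring ⟨w, hw⟩) :
    ∃ T : Finset (PlaceOver K F'), T.card = p ∧
      (∀ P' : PlaceOver K F', P' ∈ T ↔ P'.restrict (K := K) (F := F) = P) ∧
      ∀ P' ∈ T, P'.degree = P.degree ∧ P'.ord (algebraMap F F' (P.uniformizer : F)) = 1 := by
  have hp : p.Prime := Fact.out
  have hp2 : 2 ≤ p := hp.two_le
  haveI := charP_residueField p P
  obtain ⟨z, hz⟩ := hz
  set wb := IsLocalRing.residue P.toValuationSubring ⟨w, hw⟩ with hwb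
  -- the integral polynomial and its reduction
  set φ : (P.toValuationSubring)[X] := X ^ p - X - C ⟨w, hw⟩ with hφ
  have hφm : φ.Monic := monic_X_pow_sub_X_sub_C _ hp2
  have hφmap : φ.map (algebraMap P.toValuationSubring F) = X ^ p - X - C w := by
    simp only [hφ, Polynomial.map_sub, Polynomial.map_pow, map_X, map_C]; rfl
  have hmin : minpoly F y = φ.map (algebraMap P.toValuationSubring F) := by
    rw [hφmap]; exact minpoly_eq_of_pow_sub_eq hp2 hy htop hdeg
  have hnat : φ.natDegree = p := natDegree_X_pow_sub_X_sub_C _ hp2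
  have hφb : φ.map (IsLocalRing.residue P.toValuationSubring) = X ^ p - X - C wb := by
    simp only [hφ, Polynomial.map_sub, Polynomial.map_pow, map_X, map_C]
    rfl
  -- the `p` linear factors
  set lin : ℕ → (P.residueField)[X] := fun i => X - C (z + (i : P.residueField)) with hlin
  have hlininj : Set.InjOn lin (Finset.range p) := by
    intro i hi j hj hij
    rw [Finset.coe_range, Set.mem_Iio] at hi hj
    have h1 : (i : P.residueField) = j := by
      have := congrArg (fun q : (P.residueField)[X] => -(q.coeff 0)) hij
      simpa [hlin] using this
    have h2 := (CharP.natCast_eq_natCast (R := P.residueField) (p := p)).1 h1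
    exact Nat.ModEq.eq_of_lt_of_lt h2 hi hj
  set S : Finset (P.residueField)[X] := (Finset.range p).image lin with hS
  have hScard : S.card = p := by rw [hS, Finset.card_image_of_injOn hlininj, Finset.card_range]
  have hirr : ∀ γ ∈ S, Irreducible γ := fun γ hγ => by
    obtain ⟨i, -, rfl⟩ := Finset.mem_image.1 hγ; exact irreducible_X_sub_C _
  have hmon : ∀ γ ∈ S, γ.Monic := fun γ hγ => by
    obtain ⟨i, -, rfl⟩ := Finset.mem_image.1 hγ; exact monic_X_sub_C _
  have hprod : ∏ γ ∈ S, γ = φ.map (IsLocalRing.residue P.toValuationSubring) := by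
    rw [hφb, hS, Finset.prod_image hlininj, X_pow_sub_X_sub_C_eq_prod p hz]
    rfl
  obtain ⟨Φ, hinj, hall, hspec⟩ :=
    P.exists_placesOver_of_prod_eq hφm hmin (by rw [hdeg, hnat]) S hirr hmon hprod
  refine ⟨S.image Φ, ?_, ?_, ?_⟩
  · rw [Finset.card_image_of_injOn hinj, hScard]
  · intro P'
    constructor
    · intro hP'
      obtain ⟨γ, hγ, rfl⟩ := Finset.mem_image.1 hP'
      exact (hspec γ hγ).1
    · intro hP'
      obtain ⟨γ, hγ, rfl⟩ := hall P' hP'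
      exact Finset.mem_image.2 ⟨γ, hγ, rfl⟩
  · intro P' hP'
    obtain ⟨γ, hγ, rfl⟩ := Finset.mem_image.1 hP'
    obtain ⟨-, -, he, hdegeq⟩ := hspec γ hγ
    refine ⟨?_, he⟩
    obtain ⟨i, -, rfl⟩ := Finset.mem_image.1 hγ
    have h1 : (lin i).natDegree = 1 := by
      show (X - C (z + (i : P.residueField))).natDegree = 1
      exact natDegree_X_sub_C _
    rw [hdegeq, h1, one_mul]

/-- **Inert places in an Artin–Schreier extension** (Stichtenoth Prop. 3.7.8 (b) with Kummer's
theorem 3.3.7): let `y^p - y = w` generate `F'/F` of degree `p`, `w ∈ 𝒪_P`, and suppose the residue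
`w̄ ∈ F_P` is NOT of the form `z̄^p - z̄`. Then there is exactly one place of `F'` above `P`; it has
degree `p · deg P` and is unramified. (The residue polynomial `T^p - T - w̄` is irreducible over
`F_P`, Lang VI §6 Thm. 6.4.) [cite: Stichtenoth2009, Prop. 3.7.8 and Thm. 3.3.7] [cite: Lang2002, Ch. VI §6 Thm. 6.4] -/
theorem exists_placeOver_artinSchreier_inert (P : PlaceOver K F) {y : F'} {w : F}
    (hw : w ∈ P.toValuationSubring) (hy : y ^ p - y = algebraMap F F' w) (htop : F⟮y⟯ = ⊤)
    (hdeg : Module.finrank F F' = p)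
    (hz : ∀ z : P.residueField, z ^ p - z ≠ IsLocalRing.residue P.toValuationSubring ⟨w, hw⟩) :
    ∃ P' : PlaceOver K F', (∀ P'' : PlaceOver K F', P''.restrict (K := K) (F := F) = P ↔ P'' = P') ∧
      P'.degree = p * P.degree ∧ P'.ord (algebraMap F F' (P.uniformizer : F)) = 1 := by
  have hp : p.Prime := Fact.out
  have hp2 : 2 ≤ p := hp.two_le
  haveI := charP_residueField p P
  set wb := IsLocalRing.residue P.toValuationSubring ⟨w, hw⟩ with hwb
  set φ : (P.toValuationSubring)[X] := X ^ p - X - C ⟨w, hw⟩ with hφ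
  have hφm : φ.Monic := monic_X_pow_sub_X_sub_C _ hp2
  have hφmap : φ.map (algebraMap P.toValuationSubring F) = X ^ p - X - C w := by
    simp only [hφ, Polynomial.map_sub, Polynomial.map_pow, map_X, map_C]; rfl
  have hmin : minpoly F y = φ.map (algebraMap P.toValuationSubring F) := by
    rw [hφmap]; exact minpoly_eq_of_pow_sub_eq hp2 hy htop hdeg
  have hnat : φ.natDegree = p := natDegree_X_pow_sub_X_sub_C _ hp2
  have hφb : φ.map (IsLocalRing.residue P.toValuationSubring) = X ^ p - X - C wb := by
    simp only [hφ, Polynomial.map_sub, Polynomial.map_pow, map_X, map_C]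
    rfl
  have hirrb : Irreducible (X ^ p - X - C wb : (P.residueField)[X]) :=
    X_pow_sub_X_sub_C_irreducible p hz
  set S : Finset (P.residueField)[X] := {X ^ p - X - C wb} with hS
  obtain ⟨Φ, -, hall, hspec⟩ := P.exists_placesOver_of_prod_eq hφm hmin (by rw [hdeg, hnat]) S
    (fun γ hγ => by rw [hS, Finset.mem_singleton] at hγ; rw [hγ]; exact hirrb)
    (fun γ hγ => by rw [hS, Finset.mem_singleton] at hγ; rw [hγ]; exact monic_X_pow_sub_X_sub_C _ hp2)
    (by rw [hS, Finset.prod_singleton, hφb])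
  have hmem : (X ^ p - X - C wb : (P.residueField)[X]) ∈ S := by rw [hS]; exact Finset.mem_singleton_self _
  obtain ⟨hres, -, he, hdegeq⟩ := hspec _ hmem
  refine ⟨Φ (X ^ p - X - C wb), fun P'' => ⟨fun hP'' => ?_, fun hP'' => hP'' ▸ hres⟩, ?_, he⟩
  · obtain ⟨γ, hγ, hγP⟩ := hall P'' hP''
    rw [hS, Finset.mem_singleton] at hγ
    rw [← hγP, hγ]
  · rw [hdegeq, natDegree_X_pow_sub_X_sub_C _ hp2]

/-- **The trace criterion for complete splitting** (Hilbert 90 additive over the finite residue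
field `F_P ⊇ 𝔽_p`): the residue `w̄` is of the form `z̄^p - z̄` iff `Tr_{F_P/𝔽_p}(w̄) = 0`. This is
the counting form of the Artin–Schreier decomposition law `Frob_P = Tr_{F_P/𝔽_p}(w̄) ∈ 𝔽_p`.
[cite: LidlNiederreiter1996, Thm. 2.25] -/
theorem artinSchreier_split_iff_trace_eq_zero (P : PlaceOver K F) [Algebra (ZMod p) P.residueField]
    (wb : P.residueField) :
    (∃ z : P.residueField, z ^ p - z = wb) ↔ Algebra.trace (ZMod p) P.residueField wb = 0 := by
  haveI := charP_residueField p P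
  haveI : Finite P.residueField := PlaceOver.finite_residueField P
  exact FiniteField.exists_pow_sub_self_eq_iff_trace_eq_zero p wb

/-- **The contribution of an unramified place to the place counts of an Artin–Schreier extension.**
With `y^p - y = w` generating `F'/F` of degree `p` and `w ∈ 𝒪_P` with residue `w̄`: for every `s`,
`Σ_{P' | P, deg P' ∣ s} deg P'` equals `p · deg P · [deg P ∣ s]` if `w̄ ∈ ℘(F_P)` (complete
splitting into `p` places of degree `deg P`) and `p · deg P · [p · deg P ∣ s]` otherwise (one place of
degree `p · deg P`). The sum runs over the finite set of places above `P`
(`finite_setOf_restrict_eq`). [cite: Stichtenoth2009, Prop. 3.7.8 and Thm. 3.3.7] -/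
theorem sum_degree_placesOver_artinSchreier (P : PlaceOver K F) {y : F'} {w : F}
    (hw : w ∈ P.toValuationSubring) (hy : y ^ p - y = algebraMap F F' w) (htop : F⟮y⟯ = ⊤)
    (hdeg : Module.finrank F F' = p) (s : ℕ) :
    (∑ P' ∈ (P.finite_setOf_restrict_eq (F' := F')).toFinset,
        if P'.degree ∣ s then (P'.degree : ℕ) else 0) =
      if ∃ z : P.residueField, z ^ p - z = IsLocalRing.residue P.toValuationSubring ⟨w, hw⟩ then
        (if P.degree ∣ s then p * P.degree else 0)
      else (if p * P.degree ∣ s then p * P.degree else 0) := by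
  set T₀ := (P.finite_setOf_restrict_eq (F' := F')).toFinset with hT₀
  have hmemT₀ : ∀ P', P' ∈ T₀ ↔ P'.restrict (K := K) (F := F) = P := P.mem_toFinset_restrict_eq_iff (F' := F')
  split_ifs with hz hd hd'
  · -- split, `deg P ∣ s`
    obtain ⟨T, hcard, hmem, hspec⟩ := P.exists_placesOver_artinSchreier_split p hw hy htop hdeg hz
    have hT : T₀ = T := by ext P'; rw [hmemT₀, hmem]
    rw [hT]
    calc ∑ P' ∈ T, (if P'.degree ∣ s then P'.degree else 0)
        = ∑ P' ∈ T, P.degree := Finset.sum_congr rfl fun P' hP' => by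
            rw [(hspec P' hP').1, if_pos hd]
      _ = p * P.degree := by rw [Finset.sum_const, hcard, smul_eq_mul]
  · -- split, `deg P ∤ s`
    obtain ⟨T, hcard, hmem, hspec⟩ := P.exists_placesOver_artinSchreier_split p hw hy htop hdeg hz
    have hT : T₀ = T := by ext P'; rw [hmemT₀, hmem]
    rw [hT]
    exact Finset.sum_eq_zero fun P' hP' => by rw [(hspec P' hP').1, if_neg hd]
  · -- inert, `p deg P ∣ s`
    push Not at hz
    obtain ⟨P', huniq, hdegP', -⟩ := P.exists_placeOver_artinSchreier_inert p hw hy htop hdeg hz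
    have hT : T₀ = {P'} := by
      ext P''; rw [hmemT₀, Finset.mem_singleton]; exact huniq P''
    rw [hT, Finset.sum_singleton, hdegP', if_pos hd']
  · -- inert, `p deg P ∤ s`
    push Not at hz
    obtain ⟨P', huniq, hdegP', -⟩ := P.exists_placeOver_artinSchreier_inert p hw hy htop hdeg hz
    have hT : T₀ = {P'} := by
      ext P''; rw [hmemT₀, Finset.mem_singleton]; exact huniq P''
    rw [hT, Finset.sum_singleton, hdegP', if_neg hd']

end PlaceOver

end Literature.NumberTheory.DiophantineGeometry.AlgFunctionField
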